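import Literature.InformationTheory.Entanglement.SkewInformationEntanglementCriterion
import HarnessLib

/-!
# Entanglement is needed to beat the shot-noise limit: `(Δθ)² ≥ 1/N` for separable probes, `≥ 1/N²` for all
# probes, `≥ 1/((N−1)² + 1)` for biseparable probes (Pezzè–Smerzi 2009; Tóth–Apellaniz 2014 § 5; Tóth 2012)

Hodge foundations lane (`lit-hodgefound`, prover p24 gen 79; quantum-information series, file 8).  THEOREMS
ONLY: no definition, no named fact, net debt 0.  This file composes two landed results: the quantum Cramér–Rao
bound of `QuantumCramerRaoBound.lean` (g78; BF Theorem 24.2 in the non-asymptotic, locally-unbiased, single-shot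
form `1 ≤ V[θ̂]·𝓘`) and the entanglement bounds on the QFI of the collective rotations `e^{−iJ_lθ}` of the `N`-qubit
register (`QFICriterion.qfi_le_of_isSeparable` `F_Q ≤ N`, `qfi_collectiveSpin_le_sq` `F_Q ≤ N²`,
`QFIBiseparable.qfi_le_of_isBiseparable` `F_Q ≤ (N−1)² + 1`).  Vocabulary: probe `ρ` (`IsSeparable` /
`IsBiseparable` / any state), axis `l`, Hermitian SLD `T` with `Tρ + ρT = i(ρJ_l − J_lρ) = ρ̇` (BF), a POVM
`M : Ω → Matrix` (`M ω ⪰ 0`, `Σ M ω = 𝟙`), an estimator `est : Ω → ℝ` locally unbiased at `θ`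
(`Σ_ω est ω · Re Tr(ρ̇ M_ω) = 1`, BF (24.12) / Hayashi (6.73)), and its mean-square error
`V[θ̂] = Σ_ω Re Tr(ρM_ω)(est ω − θ)²`.

## Sources (read verbatim)

* L. Pezzè, A. Smerzi, PRL **102** (2009) 100401 [PezzeSmerzi2009], p. 2–3: «The goal is to estimate `θ` with a
  sensitivity overcoming the shot-noise limit `Δθ_sn ≡ 1/√N`», «the phase sensitivity is limited by a fundamental
  bound, the Quantum Cramer-Rao (QCR) [Helstrom], which only depends on the specific choice of the input state,
  `Δθ_QCR = 1/√(F_Q[ρ̂_inp, Ĵ_n]) = χ/√N` … `χ < 1` provides the class of entangled states which are useful for sub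
  shot-noise sensitivity», «shot-noise, which is the maximum limit attainable with separable states», «we obtain
  `F_Q[ρ̂_inp, Ĵ_n] ≤ N²`. Then, from Eq. (cr), follows that `Δθ_HL` is the highest possible phase sensitivity.»
* G. Tóth, I. Apellaniz, J. Phys. A **47** (2014) 424006 [TothApellaniz2014], §5.2: «All states violating
  [`F_Q[ϱ,J_l] ≤ N`] are entangled. Such states make it possible to surpass the shot-noise limit … we obtained in
  eq. (F2eb) the shot-noise scaling, while in eq. (He) the Heisenberg scaling»; §5.3: «we can conclude that full
  `N`-partite entanglement is needed to reach a maximal metrological sensitivity.»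
* G. Tóth, PRA **85** (2012) 022322 [Toth2012MultipartiteMetrology], p. 3: «To reach the maximal phase sensitivity,
  genuine multipartite entanglement is needed.»

## What is formalized (all PROVED; single-shot `m = 1`, the `m`-copy additivity of `F_Q` is not in the tree)

`trace_sld_re_eq_zero` (`Tr ρ̇ = 0` for a unitary family), **`shotNoise_of_isSeparable`** (`1 ≤ V[θ̂]·N` for every
fully separable probe, every axis, SLD, POVM and locally unbiased estimator), **`not_isSeparable_of_sub_shotNoise`**
(«useful» sub-shot-noise sensitivity `V[θ̂]·N < 1` certifies entanglement), **`heisenberg_limit`** (`1 ≤ V[θ̂]·N²`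
for every probe), **`gme_limit_of_isBiseparable`** (`1 ≤ V[θ̂]·((N−1)² + 1)` for biseparable probes) and
`not_isBiseparable_of_lt` (beating it certifies genuine multipartite entanglement).

NOT formalized: `m` independent repetitions (`1/(mF_Q)`), asymptotic attainability, the converse «necessary and
sufficient» direction of Pezzè–Smerzi (existence of a POVM/estimator reaching `1/F_Q` is BF (24.41)–(24.42),
`CramerRao.fisherInfo_sld_eigenbasis_eq_qfi`, but an estimator attaining the classical bound is asymptotic).
Tree search (FAIL-DUP, 2026-09-01): `rg -il "shot.noise" Literature` → `SpinSqueezingCriterion.lean`,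
`CollectiveSpinVarianceBound.lean` (prose only); no Cramér–Rao consequence for separable probes.
-/

noncomputable section

open scoped BigOperators ComplexOrder ComplexConjugate
open Matrix Complex Finset
open Literature.Computability.QuantumComplexity
open Literature.InformationTheory.Entanglement.Tsirelson
open Literature.InformationTheory.StateDiscrimination

namespace Literature.InformationTheory.Entanglement

namespace ShotNoise

open SpinSqueezing GHZWitness UnentangledSpins QFICriterion QFIBiseparable SkewInfoCriterion

variable {N : ℕ} {Ω : Type*} [Fintype Ω]

/-- `Re(2z) = 2Re z` (the two spellings of the QFI in the tree). [folklore] -/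
private theorem re_two_mul (z : ℂ) : (2 * z).re = 2 * z.re := by
  simp only [Complex.mul_re, Complex.re_ofNat, Complex.im_ofNat, zero_mul, sub_zero]

/-- `Tr ρ̇ = 0` along a unitary family: `Re Tr(Tρ + ρT) = 0` when `Tρ + ρT = i(ρJ − Jρ)`. [cite: PezzeSmerzi2009,
p. 2 («`ρ̂_out(θ) = e^{iθĴ_n} ρ̂_inp e^{−iθĴ_n}`»)] -/
theorem trace_sld_re_eq_zero {ρ T J : Matrix (Fin N → Bool) (Fin N → Bool) ℂ}
    (hTρ : T * ρ + ρ * T = Complex.I • (ρ * J - J * ρ)) : (T * ρ + ρ * T).trace.re = 0 := by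
  rw [hTρ, QFIVariance.trace_unitaryDeriv, Complex.zero_re]

/-- **The shot-noise limit for separable probes** («shot-noise, which is the maximum limit attainable with separable
states»; TA: the bound `F_Q ≤ N` is «the shot-noise scaling»): for a fully separable `N`-qubit probe rotated about
`J_l`, every Hermitian SLD `T`, every POVM `{M_ω}` and every locally unbiased estimator,
`V[θ̂]·N ≥ V[θ̂]·F_Q[ρ, J_l] ≥ 1`, i.e. `(Δθ)² ≥ 1/N = Δθ_sn²`. [cite: PezzeSmerzi2009, p. 2–3 (eqs. (cr) and
`Δθ_sn ≡ 1/√N`)] [cite: TothApellaniz2014, §5.2 (F2eb) with §2 eq. (shotnoise)] -/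
theorem shotNoise_of_isSeparable (l : Pauli) {ρ T : Matrix (Fin N → Bool) (Fin N → Bool) ℂ} (hρ : IsSeparable ρ)
    (hT : T.IsHermitian) (hTρ : T * ρ + ρ * T = Complex.I • (ρ * collectiveSpin l N - collectiveSpin l N * ρ))
    {M : Ω → Matrix (Fin N → Bool) (Fin N → Bool) ℂ} (hM : ∀ ω, (M ω).PosSemidef) (hM1 : ∑ ω, M ω = 1)
    (est : Ω → ℝ) (θ : ℝ) (hlu : ∑ ω, est ω * ((T * ρ + ρ * T) * M ω).trace.re = 1) :
    1 ≤ (∑ ω, (ρ * M ω).trace.re * (est ω - θ) ^ 2) * N := by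
  have hρ0 := posSemidef_of_isSeparable hρ
  have hcr := CramerRao.quantumCramerRao hρ0 hT hM hM1 est θ (trace_sld_re_eq_zero hTρ) hlu
  have hF := qfi_le_of_isSeparable l hρ hT hTρ
  rw [hTρ] at hcr
  rw [re_two_mul] at hF
  have hV : 0 ≤ ∑ ω, (ρ * M ω).trace.re * (est ω - θ) ^ 2 :=
    sum_nonneg fun ω _ => mul_nonneg (Literature.LinearAlgebra.Matrix.re_trace_mul_nonneg_of_posSemidef hρ0 (hM ω))
      (sq_nonneg _)
  exact hcr.trans (mul_le_mul_of_nonneg_left hF hV)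

/-- **Sub-shot-noise sensitivity certifies entanglement** («`χ < 1` provides the class of entangled states which are
useful for sub shot-noise sensitivity»): if some POVM and locally unbiased estimator achieve `V[θ̂]·N < 1` on the probe
`ρ` rotated about `J_l` (with Hermitian SLD `T`), then `ρ` is not fully separable. [cite: PezzeSmerzi2009, p. 3
(«a necessary and sufficient condition for sub shot-noise phase estimation»)] [cite: TothApellaniz2014, §5.2] -/
theorem not_isSeparable_of_sub_shotNoise (l : Pauli) {ρ T : Matrix (Fin N → Bool) (Fin N → Bool) ℂ}
    (hT : T.IsHermitian) (hTρ : T * ρ + ρ * T = Complex.I • (ρ * collectiveSpin l N - collectiveSpin l N * ρ))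
    {M : Ω → Matrix (Fin N → Bool) (Fin N → Bool) ℂ} (hM : ∀ ω, (M ω).PosSemidef) (hM1 : ∑ ω, M ω = 1)
    (est : Ω → ℝ) (θ : ℝ) (hlu : ∑ ω, est ω * ((T * ρ + ρ * T) * M ω).trace.re = 1)
    (hsub : (∑ ω, (ρ * M ω).trace.re * (est ω - θ) ^ 2) * N < 1) : ¬ IsSeparable ρ :=
  fun hρ => absurd (shotNoise_of_isSeparable l hρ hT hTρ hM hM1 est θ hlu) (not_le.mpr hsub)

/-- **The Heisenberg limit** («`F_Q[ρ̂_inp, Ĵ_n] ≤ N²`. Then, from Eq. (cr), follows that `Δθ_HL` is the highest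
possible phase sensitivity»): for EVERY probe state (`ρ ⪰ 0`, `Tr ρ = 1`), `V[θ̂]·N² ≥ 1`. [cite: PezzeSmerzi2009,
p. 3] [cite: TothApellaniz2014, §5.2 eq. (He) with §2 eq. (Heisenberg)] -/
theorem heisenberg_limit (l : Pauli) {ρ T : Matrix (Fin N → Bool) (Fin N → Bool) ℂ} (hρ : ρ.PosSemidef)
    (hρ1 : ρ.trace = 1) (hT : T.IsHermitian)
    (hTρ : T * ρ + ρ * T = Complex.I • (ρ * collectiveSpin l N - collectiveSpin l N * ρ))
    {M : Ω → Matrix (Fin N → Bool) (Fin N → Bool) ℂ} (hM : ∀ ω, (M ω).PosSemidef) (hM1 : ∑ ω, M ω = 1)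
    (est : Ω → ℝ) (θ : ℝ) (hlu : ∑ ω, est ω * ((T * ρ + ρ * T) * M ω).trace.re = 1) :
    1 ≤ (∑ ω, (ρ * M ω).trace.re * (est ω - θ) ^ 2) * (N : ℝ) ^ 2 := by
  have hcr := CramerRao.quantumCramerRao hρ hT hM hM1 est θ (trace_sld_re_eq_zero hTρ) hlu
  have hF := qfi_collectiveSpin_le_sq l hρ hρ1 hT hTρ
  rw [hTρ] at hcr
  rw [re_two_mul] at hF
  have hV : 0 ≤ ∑ ω, (ρ * M ω).trace.re * (est ω - θ) ^ 2 :=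
    sum_nonneg fun ω _ => mul_nonneg (Literature.LinearAlgebra.Matrix.re_trace_mul_nonneg_of_posSemidef hρ (hM ω))
      (sq_nonneg _)
  exact hcr.trans (mul_le_mul_of_nonneg_left hF hV)

/-- **Genuine multipartite entanglement is needed for the maximal sensitivity** («To reach the maximal phase
sensitivity, genuine multipartite entanglement is needed»; TA: «full `N`-partite entanglement is needed to reach a
maximal metrological sensitivity»): for a biseparable probe, `V[θ̂]·((N−1)² + 1) ≥ 1`. [cite:
Toth2012MultipartiteMetrology, p. 3 (after (bisep))] [cite: TothApellaniz2014, §5.3 (after (bisep))] -/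
theorem gme_limit_of_isBiseparable (l : Pauli) {ρ T : Matrix (Fin N → Bool) (Fin N → Bool) ℂ}
    (hρ : IsBiseparable ρ) (hT : T.IsHermitian)
    (hTρ : T * ρ + ρ * T = Complex.I • (ρ * collectiveSpin l N - collectiveSpin l N * ρ))
    {M : Ω → Matrix (Fin N → Bool) (Fin N → Bool) ℂ} (hM : ∀ ω, (M ω).PosSemidef) (hM1 : ∑ ω, M ω = 1)
    (est : Ω → ℝ) (θ : ℝ) (hlu : ∑ ω, est ω * ((T * ρ + ρ * T) * M ω).trace.re = 1) :
    1 ≤ (∑ ω, (ρ * M ω).trace.re * (est ω - θ) ^ 2) * (((N : ℝ) - 1) ^ 2 + 1) := by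
  have hρ0 := posSemidef_of_isBiseparable hρ
  have hcr := CramerRao.quantumCramerRao hρ0 hT hM hM1 est θ (trace_sld_re_eq_zero hTρ) hlu
  have hF := qfi_le_of_isBiseparable l hρ hT hTρ
  rw [hTρ] at hcr
  rw [re_two_mul] at hF
  have hV : 0 ≤ ∑ ω, (ρ * M ω).trace.re * (est ω - θ) ^ 2 :=
    sum_nonneg fun ω _ => mul_nonneg (Literature.LinearAlgebra.Matrix.re_trace_mul_nonneg_of_posSemidef hρ0 (hM ω))
      (sq_nonneg _)
  exact hcr.trans (mul_le_mul_of_nonneg_left hF hV)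

/-- **Beating `(Δθ)² = 1/((N−1)² + 1)` certifies genuine multipartite entanglement.** [cite:
Toth2012MultipartiteMetrology, p. 3 («Any state that violates Eq. (bisep-1) … is genuine multipartite entangled»)]
[cite: TothApellaniz2014, §5.3] -/
theorem not_isBiseparable_of_lt (l : Pauli) {ρ T : Matrix (Fin N → Bool) (Fin N → Bool) ℂ} (hT : T.IsHermitian)
    (hTρ : T * ρ + ρ * T = Complex.I • (ρ * collectiveSpin l N - collectiveSpin l N * ρ))
    {M : Ω → Matrix (Fin N → Bool) (Fin N → Bool) ℂ} (hM : ∀ ω, (M ω).PosSemidef) (hM1 : ∑ ω, M ω = 1)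
    (est : Ω → ℝ) (θ : ℝ) (hlu : ∑ ω, est ω * ((T * ρ + ρ * T) * M ω).trace.re = 1)
    (hlt : (∑ ω, (ρ * M ω).trace.re * (est ω - θ) ^ 2) * (((N : ℝ) - 1) ^ 2 + 1) < 1) : ¬ IsBiseparable ρ :=
  fun hρ => absurd (gme_limit_of_isBiseparable l hρ hT hTρ hM hM1 est θ hlu) (not_le.mpr hlt)

end ShotNoise

end Literature.InformationTheory.Entanglement
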